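import Literature.Computability.AlgebraicComplexity.FormDiscriminantExists
import Literature.Computability.AlgebraicComplexity.DeterminantalConormalBoundPlane
import Mathlib.Algebra.Polynomial.Roots
import HarnessLib

/-!
# The discriminant of forms of degree `D` is homogeneous of positive degree

Topic `Literature/Computability/AlgebraicComplexity` (cell `val-lit`, row BI2017-A: brick (3) of the
Mumford route to `BI2017_prop_2_10` — «there is a NON-CONSTANT HOMOGENEOUS `SL_m`-invariant vanishing
exactly on the singular forms»; supplement to `FormDiscriminantExists.lean`). Theorems only — no
definition, no named fact.

The ideal `I_S ⊆ ℂ[Sym^D ℂ^{n+2}]` of polynomial functions vanishing on the singular forms of degree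
`D` (`FormSingularLocusPrime.lean`: `I_S = ker (Φ ↦ Φ(singFamilyCoeff))`, a non-zero prime) is a
HOMOGENEOUS ideal, because the singular forms are a cone: with `F` also every `t • F` is singular, and a
polynomial vanishing on the line `t ↦ t • y` has all its homogeneous components vanishing at `y`
(§1–§2). Consequently any generator `Δ` of `I_S` (when principal — part II-A supplies
`height I_S ≤ 1`) divides its own non-zero homogeneous components and is therefore itself
homogeneous (tree `DeterminantalConormal.isHomogeneous_of_dvd_isHomogeneous`), of positive degree
since `I_S ≠ ⊤` (§3). §4 packages the statement in the signature of the programme's brick-A spec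
(cell file `HOME/bip/NOTE-t09g6-Mumford-route.md`): `exists_isSLInvariantCoord_discriminant`.

Honest framing: classical invariant theory (Gelfand–Kapranov–Zelevinsky Ch. 1; Mumford–Fogarty–Kirwan
Prop. 4.2 «a definite homogeneous polynomial `Δ` in its coefficients»), bookkeeping for row BI2017-A;
typed ≠ endorsed; nothing here bears on `VP` versus `VNP`, which is NOT proved.

## References

* I. M. Gelfand, M. M. Kapranov, A. V. Zelevinsky, *Discriminants, Resultants, and
  Multidimensional Determinants*, Birkhäuser 1994, Ch. 1 §1 [GelfandKapranovZelevinsky1994].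
* D. Mumford, J. Fogarty, F. Kirwan, *Geometric Invariant Theory*, 3rd ed., Springer 1994, Chap. 4
  §2 Prop. 4.2 (proof; held text `book:mumford1994-geometric-invariant-theory` p0086:L22)
  [MumfordFogartyKirwan1994].
* [BurgisserIkenmeyer2017] P. Bürgisser, C. Ikenmeyer, J. Algebra 477 (2017), §3 (the graded ring
  `O(Sym^D ℂ^m)^{SL_m}`), Prop. 2.10 (consumer).
-/

noncomputable section

open MvPolynomial Matrix

namespace Literature.Computability.AlgebraicComplexity

open Literature.AlgebraicGeometry.Motives.SmoothHypersurface

namespace FormDiscriminant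

variable {n D : ℕ}

/-! ### §1 Polynomials vanishing on a line through the origin -/

section Cone

variable {τ : Type*}

/-- `Φ(t • y) = t ^ i · Φ(y)` for `Φ` homogeneous of degree `i` (scaling of the argument). [folklore] -/
private theorem aeval_smul_of_isHomogeneous {Φ : MvPolynomial τ ℂ} {i : ℕ} (hΦ : Φ.IsHomogeneous i)
    (t : ℂ) (y : τ → ℂ) : aeval (t • y) Φ = t ^ i * aeval y Φ := by
  classical
  rw [Φ.as_sum, map_sum, map_sum, Finset.mul_sum]
  refine Finset.sum_congr rfl fun s hs => ?_
  simp only [aeval_monomial, Pi.smul_apply, smul_eq_mul, mul_pow, Finsupp.prod,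
    Finset.prod_mul_distrib]
  rw [Finset.prod_pow_eq_pow_sum, ← hΦ.degree_eq_sum_deg_support hs]
  simp only [Algebra.algebraMap_self, RingHom.id_apply]
  ring

/-- **A polynomial vanishing on the whole line `ℂ · y` has every homogeneous component vanishing at
`y`**: `t ↦ Φ(t • y) = Σ_i Φ_i(y) t^i` is the zero polynomial function on the infinite field `ℂ`, so
its coefficients `Φ_i(y)` vanish (this is why the ideal of a cone is homogeneous). [folklore] -/
private theorem aeval_homogeneousComponent_eq_zero_of_forall_smul (Φ : MvPolynomial τ ℂ) (y : τ → ℂ)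
    (h : ∀ t : ℂ, aeval (t • y) Φ = 0) (i : ℕ) :
    aeval y (homogeneousComponent i Φ) = 0 := by
  classical
  -- beyond the total degree the component is zero
  by_cases hi : Φ.totalDegree < i
  · rw [homogeneousComponent_eq_zero _ _ hi, map_zero]
  rw [not_lt] at hi
  -- the one-variable polynomial `P(t) = Σ_i Φ_i(y) t^i`
  set N := Φ.totalDegree with hN
  set P : Polynomial ℂ :=
    ∑ j ∈ Finset.range (N + 1), Polynomial.C (aeval y (homogeneousComponent j Φ)) * Polynomial.X ^ j
    with hP
  have hPeval : ∀ t : ℂ, P.eval t = aeval (t • y) Φ := by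
    intro t
    rw [hP, Polynomial.eval_finsetSum]
    conv_rhs => rw [← sum_homogeneousComponent (φ := Φ), map_sum]
    refine Finset.sum_congr rfl fun j _ => ?_
    rw [Polynomial.eval_mul, Polynomial.eval_C, Polynomial.eval_pow, Polynomial.eval_X,
      aeval_smul_of_isHomogeneous (homogeneousComponent_isHomogeneous j Φ), mul_comm]
  have hP0 : P = 0 := by
    refine Polynomial.funext fun t => ?_
    rw [hPeval, h t, Polynomial.eval_zero]
  -- read off the `i`-th coefficient
  have hcoeff : P.coeff i = aeval y (homogeneousComponent i Φ) := by
    rw [hP, Polynomial.finsetSum_coeff]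
    simp only [Polynomial.coeff_C_mul_X_pow]
    rw [Finset.sum_ite_eq (Finset.range (N + 1)) i, if_pos (Finset.mem_range.2 (by omega))]
  rw [← hcoeff, hP0, Polynomial.coeff_zero]

end Cone

/-! ### §2 The ideal of the singular forms is homogeneous -/

section Homogeneous

/-- A scalar multiple of a form that is not nonsingular is not nonsingular (the singular forms are a
cone; the zero form included). [cite: MumfordFogartyKirwan1994, Chap. 4 §2 Prop. 4.2 (proof)] -/
theorem not_isNonsingularForm_smul {F : MvPolynomial (Fin (n + 2)) ℂ} (hF : ¬ IsNonsingularForm ℂ F)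
    (t : ℂ) : ¬ IsNonsingularForm ℂ (t • F) := by
  rw [isNonsingularForm_iff_forall_exists_eval_pderiv_ne_zero] at hF ⊢
  push Not at hF ⊢
  obtain ⟨z, hz, hFz, hdF⟩ := hF
  refine ⟨z, hz, ?_, fun j => ?_⟩
  · rw [smul_eval, hFz, mul_zero]
  · rw [(pderiv j).map_smul_of_tower, smul_eval, hdF j, mul_zero]

/-- **`I_S` is a homogeneous ideal**: every homogeneous component of a polynomial function vanishing
on the singular forms of degree `D ≥ 2` vanishes on them (the singular forms are a cone,
`aeval_homogeneousComponent_eq_zero_of_forall_smul`). [cite: GelfandKapranovZelevinsky1994, Ch. 1 §1 (the discriminant hypersurface)] -/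
theorem homogeneousComponent_mem_ker_singFamily (hD : 2 ≤ D)
    {Φ : MvPolynomial (DegIdx (Fin (n + 2)) D) ℂ}
    (hΦ : Φ ∈ RingHom.ker (aeval (R := ℂ) (singFamilyCoeff (n := n) (D := D))).toRingHom) (i : ℕ) :
    homogeneousComponent i Φ ∈
      RingHom.ker (aeval (R := ℂ) (singFamilyCoeff (n := n) (D := D))).toRingHom := by
  rw [RingHom.mem_ker] at hΦ ⊢
  change aeval (R := ℂ) (singFamilyCoeff (n := n) (D := D)) Φ = 0 at hΦ
  change aeval (R := ℂ) (singFamilyCoeff (n := n) (D := D)) (homogeneousComponent i Φ) = 0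
  rw [← forall_singular_aeval_eq_zero_iff hD] at hΦ ⊢
  intro F hF hsing
  refine aeval_homogeneousComponent_eq_zero_of_forall_smul Φ (formCoeff D F) (fun t => ?_) i
  rw [← formCoeff_smul]
  refine hΦ (t • F) ?_ (not_isNonsingularForm_smul hsing t)
  rw [smul_eq_C_mul]
  exact hF.C_mul t

end Homogeneous

/-! ### §3 A generator of `I_S` is homogeneous of positive degree -/

section Generator

/-- **A generator of `I_S` is homogeneous**: `Δ` divides each of its own homogeneous components
(they lie in the homogeneous ideal `I_S = (Δ)`), one of which is non-zero, and a divisor of a non-zero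
form is a form (`DeterminantalConormal.isHomogeneous_of_dvd_isHomogeneous`).
[cite: GelfandKapranovZelevinsky1994, Ch. 1 §1 (the discriminant hypersurface)] -/
theorem isHomogeneous_of_ker_singFamily_eq_span (hD : 2 ≤ D)
    {Δ : MvPolynomial (DegIdx (Fin (n + 2)) D) ℂ}
    (hΔ : RingHom.ker (aeval (R := ℂ) (singFamilyCoeff (n := n) (D := D))).toRingHom =
      Ideal.span {Δ}) : Δ.IsHomogeneous Δ.totalDegree := by
  classical
  have hΔ0 : Δ ≠ 0 := ne_zero_of_ker_singFamily_eq_span hD hΔ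
  -- a non-zero homogeneous component
  obtain ⟨i, hi⟩ : ∃ i, homogeneousComponent i Δ ≠ 0 := by
    by_contra hcon
    push Not at hcon
    apply hΔ0
    rw [← sum_homogeneousComponent (φ := Δ)]
    exact Finset.sum_eq_zero fun j _ => hcon j
  -- it lies in `I_S = (Δ)`
  have hmem : homogeneousComponent i Δ ∈ Ideal.span {Δ} := by
    rw [← hΔ]
    refine homogeneousComponent_mem_ker_singFamily hD ?_ i
    rw [hΔ]
    exact Ideal.mem_span_singleton_self Δ
  rw [Ideal.mem_span_singleton] at hmem
  exact DeterminantalConormal.isHomogeneous_of_dvd_isHomogeneous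
    (homogeneousComponent_isHomogeneous i Δ) hi hmem

/-- **A generator of `I_S` has positive degree**: a constant generator would be zero (excluded,
`I_S ≠ ⊥`) or a unit (excluded, `I_S` is prime). [cite: GelfandKapranovZelevinsky1994, Ch. 1 §1 (the discriminant hypersurface)] -/
theorem totalDegree_pos_of_ker_singFamily_eq_span (hD : 2 ≤ D)
    {Δ : MvPolynomial (DegIdx (Fin (n + 2)) D) ℂ}
    (hΔ : RingHom.ker (aeval (R := ℂ) (singFamilyCoeff (n := n) (D := D))).toRingHom =
      Ideal.span {Δ}) : 0 < Δ.totalDegree := by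
  have hΔ0 : Δ ≠ 0 := ne_zero_of_ker_singFamily_eq_span hD hΔ
  rw [pos_iff_ne_zero]
  intro h0
  rw [totalDegree_eq_zero_iff_eq_C] at h0
  have hc : coeff 0 Δ ≠ 0 := by
    intro hc
    apply hΔ0
    rw [h0, hc, C_0]
  have hunit : IsUnit Δ := by
    rw [h0]
    exact (Ne.isUnit hc).map C
  have htop : Ideal.span {Δ} = ⊤ := Ideal.span_singleton_eq_top.2 hunit
  have hprime := isPrime_ker_singFamily (n := n) (D := D)
  rw [hΔ, htop] at hprime
  exact hprime.ne_top rfl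

/-- **A generator of `I_S` is a non-constant form**: homogeneous of some positive degree `e`.
[cite: MumfordFogartyKirwan1994, Chap. 4 §2 Prop. 4.2 (proof)] -/
theorem exists_isHomogeneous_of_ker_singFamily_eq_span (hD : 2 ≤ D)
    {Δ : MvPolynomial (DegIdx (Fin (n + 2)) D) ℂ}
    (hΔ : RingHom.ker (aeval (R := ℂ) (singFamilyCoeff (n := n) (D := D))).toRingHom =
      Ideal.span {Δ}) : ∃ e : ℕ, 0 < e ∧ Δ.IsHomogeneous e :=
  ⟨Δ.totalDegree, totalDegree_pos_of_ker_singFamily_eq_span hD hΔ,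
    isHomogeneous_of_ker_singFamily_eq_span hD hΔ⟩

end Generator

/-! ### §4 The discriminant as a non-constant homogeneous `SL`-invariant -/

section Packaged

/-- **The discriminant, brick-A signature (modulo the height bound of part II-A)**: for `D ≥ 2` and
`height I_S ≤ 1` there is a non-zero polynomial function `q` on `Sym^D ℂ^{n+2}`, HOMOGENEOUS OF SOME
POSITIVE DEGREE, `SL_{n+2}`-invariant, vanishing at a form `f` of degree `D` iff `f` is not
nonsingular — Mumford–Fogarty–Kirwan's «definite homogeneous polynomial `Δ` in its coefficients …
`Δ` must be invariant». [cite: MumfordFogartyKirwan1994, Chap. 4 §2 Prop. 4.2 (proof)] -/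
theorem exists_isSLInvariantCoord_discriminant (n D : ℕ) (hD : 2 ≤ D)
    (hI : (RingHom.ker (aeval (R := ℂ) (singFamilyCoeff (n := n) (D := D))).toRingHom).height ≤ 1) :
    ∃ q : MvPolynomial (DegIdx (Fin (n + 2)) D) ℂ, q ≠ 0 ∧ (∃ e, 0 < e ∧ q.IsHomogeneous e) ∧
      IsSLInvariantCoord D q ∧
      ∀ f : MvPolynomial (Fin (n + 2)) ℂ, f.IsHomogeneous D →
        (aeval (formCoeff D f) q = 0 ↔ ¬ IsNonsingularForm ℂ f) := by
  obtain ⟨Δ, -, hΔ⟩ := exists_prime_ker_singFamily_eq_span hD hI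
  exact ⟨Δ, ne_zero_of_ker_singFamily_eq_span hD hΔ,
    exists_isHomogeneous_of_ker_singFamily_eq_span hD hΔ,
    isSLInvariantCoord_of_ker_singFamily_eq_span hD hΔ,
    fun f hf => aeval_eq_zero_iff_not_isNonsingularForm_of_ker_eq_span hD hΔ hf⟩

/-- **The discriminant, full dossier (modulo the height bound of part II-A)**: prime, homogeneous of
positive degree, `SL`-invariant, generating `I_S` and the vanishing ideal of the singular forms, with
zero set exactly the singular forms of degree `D`. [cite: GelfandKapranovZelevinsky1994, Ch. 1 §1 (the discriminant hypersurface)]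
[cite: MumfordFogartyKirwan1994, Chap. 4 §2 Prop. 4.2 (proof)] -/
theorem exists_prime_isHomogeneous_discriminant_form (hD : 2 ≤ D)
    (hI : (RingHom.ker (aeval (R := ℂ) (singFamilyCoeff (n := n) (D := D))).toRingHom).height ≤ 1) :
    ∃ Δ : MvPolynomial (DegIdx (Fin (n + 2)) D) ℂ, Prime Δ ∧
      Δ.IsHomogeneous Δ.totalDegree ∧ 0 < Δ.totalDegree ∧ IsSLInvariantCoord D Δ ∧
      RingHom.ker (aeval (R := ℂ) (singFamilyCoeff (n := n) (D := D))).toRingHom = Ideal.span {Δ} ∧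
      MvPolynomial.vanishingIdeal ℂ (formCoeff D ''
        {F : MvPolynomial (Fin (n + 2)) ℂ | F.IsHomogeneous D ∧ ¬ IsNonsingularForm ℂ F}) =
          Ideal.span {Δ} ∧
      ∀ F : MvPolynomial (Fin (n + 2)) ℂ, F.IsHomogeneous D →
        (aeval (formCoeff D F) Δ = 0 ↔ ¬ IsNonsingularForm ℂ F) := by
  obtain ⟨Δ, hprime, hΔ⟩ := exists_prime_ker_singFamily_eq_span hD hI
  exact ⟨Δ, hprime, isHomogeneous_of_ker_singFamily_eq_span hD hΔ,
    totalDegree_pos_of_ker_singFamily_eq_span hD hΔ,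
    isSLInvariantCoord_of_ker_singFamily_eq_span hD hΔ, hΔ,
    (vanishingIdeal_singularForms_eq_ker hD).trans hΔ,
    fun F hF => aeval_eq_zero_iff_not_isNonsingularForm_of_ker_eq_span hD hΔ hF⟩

end Packaged

end FormDiscriminant

end Literature.Computability.AlgebraicComplexity

end
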